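import Literature.IUT.LogThetaLattice.BiCoresOfKitsRealifiedD
import Literature.IUT.LogThetaLattice.BiCoresRealifiedKummerNaturality
import Literature.IUT.HodgeArakelov.RealifiedDFunctorSmall
import HarnessLib

/-!
# `BiCoricKit.withRealifiedD`: the kit-level bi-coric datum with the [IUTchII] Cor 4.5 (ii) slot REPLACED CANONICALLY by
# `D^⊢ ↦ (D^⊩(D^⊢), Prime ⥲ V̲, {ρ_{D^⊩,v}})` — and [IUTchIII] Thm 1.5 (v) / Prop 2.1 (vi) as THEOREMS for the companion glue

Mochizuki, *Inter-universal Teichmüller Theory III*, kurims manuscript (May 2020), §1 Thm 1.5 (v) pp.50–51 («induce [cf. [IUTchII],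
Corollaries 4.5, (ii); 4.10, (v)] an isomorphism of collections of data … compatible … with the `ℝ_{>0}`-orbits of the isomorphisms of
[IUTchII] Corollary 4.6, (ii)»), §2 Prop 2.1 (vi) pp.60–61; *II* (Dec 2020) Cor 4.5 (ii) p.132, Cor 4.6 (ii) p.133, Cor 4.10 (v)
pp.160–161. [claim: Mochizuki2012, status: disputed] (D-0012 claim key). abc-iut cell, seat abc-iut-w4-d005 (gen 4), row
«BiCoricKit.withRealifiedD» (OFFERED by the zone owner abc-iut-L6-t3 g5, STATUS 2026-08-26T08:15:03Z; TAKEN 08:31:49Z).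
ONE definition (`BiCoricKit.withRealifiedD`; post-freeze def, reading (ii)) + theorems (the glue-level
`LatticeGlueKit.withRealifiedD` is in the sequel file); every other piece is consumed BY NAME: abc-iut-L6-t3 `BiCoricKit` / `BiCoricData.ofKits` / `LatticeGlueKit` /
`LatticeGlue.ofKits` / `transportUnitPortion` / `KummerCoherent` / `realifiedKummer_map_of_full`, abc-iut-w4-d009 `RlfData` /
`realifiedD` / `thm15vSingleIso_ofKits_of_realifiedD` / `realifiedRigidAt_ofKits_of_realifiedD`, this seat's gen 2 `RlfImage` /
`realifiedDSmall` / `realifiedDSmallForgetIso` / `rlfImage_exists_ne_id`.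

WHAT THIS FILE DOES. A kit-level bi-coric datum `Bk : BiCoricKit X` carries the [IUTchII] Cor 4.5 (ii) / 4.6 (ii) / 4.10 (v) slot
(`RFrob`, `realified`, `realifiedHT`, `realifiedKummer`) as INPUT BY NAME. Given the object-level inputs of Cor 4.5 (ii) — the pointed
real lines `line : M.DMono → 𝕍 → RLine` (`R_{≥0}(‡D^⊢)_v ∋ log^{‡D^⊢}(p_v)`, [AbsTopIII] Prop 5.8) and the positive scalars `c` of the
`ρ_{D^⊩,v}` ([IUTchI] Ex 3.5 (iii)) — `Bk.withRealifiedD line c hc` is `Bk` with that slot REPLACED CANONICALLY: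
`RFrob := RlfImage line c hc` (the small model of abc-iut-w4-d009's `ℝ_{>0}`-torsor category `RlfData`), `realified :=
realifiedDSmall line c hc` (Cor 4.5 (ii)'s functor), `realifiedHT := (†ℋ𝒯 ↦ †ℋ𝒯^𝒟 ↦ †𝔇^⊢_△) ⋙ realifiedDSmall` (LABELLED CHOICE: the
Frobenius-like realified datum `(^{n,m}C^⊩_△, …)` of [IUTchII] Cor 4.10 (i) is ROUTED THROUGH `dvDelta`; print keeps a separate
Frobenius-like copy isomorphic to it — [IUTchII] Cor 4.6 (ii)), `realifiedKummer := PolyIso.full` (= the whole `ℝ_{>0}`-orbit,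
gen-2 `rlfImage_full_map_eq_orbit`). THEN, with NO hypothesis beyond the kit inputs by name:
* kit level: the `ℝ_{>0}`-orbit transport law of Thm 1.5 (v) / Cor 4.6 (ii) (GAP G-w4d026-1's literal shape) HOLDS
  (`withRealifiedD_realifiedKummer_map`); `RFrob` is the genuine torsor shape, NOT rigid (`withRealifiedD_RFrob_exists_ne_id`);
* real frame `B := BiCoricData.ofKits … (Bk.withRealifiedD line c hc)`: **Thm 1.5 (v) «induce AN isomorphism» —
  `thm15vSingleIso_ofKits_withRealifiedD : B.Thm15vSingleIso`** and the consumer hypothesis **`realifiedRigidAt_ofKits_withRealifiedD`**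
  (FACT-LIST F-2067 / F-2066 shapes at this `B`), by abc-iut-w4-d009's route with the IDENTITY reading (`Φ₀ := 𝟭`,
  `U₀ := inducedFunctor _`, `η₀ :=` an identity); every frame-level orbit is full (`ofKits_withRealifiedD_realifiedKummer_eq_full`) so the
  frame-level transport law HOLDS (`ofKits_withRealifiedD_realifiedKummer_map`);
* glue level (SEQUEL FILE `LatticeGlueOfKitsWithRealifiedD.lean`, gated on the olean of abc-iut-L6-t3's p431830
  `LatticeGlueTransportedUnitPortion`): for ANY `Gk : LatticeGlueKit hR X`, the companion glue
  `(LatticeGlue.ofKits … (Gk.withRealifiedD …)).transportUnitPortion` is `KummerCoherent` and satisfies Thm 1.5 (v) — the two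
  [IUTchIII] §1–§2 rows of `Layer6ResidualB` (Thm 1.5 (v), Prop 2.1 (vi)) as THEOREMS for the canonical companion glue.

HONEST SCOPE: which realified datum / which [IUTchII] Cor 4.10 (iv) identification the GENUINE kits carry remains the input BY NAME of
abc-iut-L6-t2 / abc-iut-L5 (the companion is a canonical CHOICE of those slots, disclosed above); nothing here takes a side on
[IUTchIII] Cor. 3.12; typed ≠ proved; instantiated ≠ endorsed.
-/

noncomputable section

namespace Literature.IUT.LogThetaLattice

open CategoryTheory
open Literature.IUT.HodgeTheaters Literature.IUT.HodgeTheaters.PMBaseKit Literature.IUT.HodgeArakelov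
open Literature.AnabelianGeometry.AbsoluteAnabelian AsSmallTransport

universe u

variable {l : ℕ} {K : PMBaseKit.{u} l} {M : K.MultKit} {FK : K.FKit M} {L : FK.MonoLaws}

/-! ### 1. Kit level -/

namespace BiCoricKit

variable {X : TimesMuSide FK L} (Bk : BiCoricKit X)
  (line : M.DMono → K.V → RLine.{u}) (c : K.V → ℝ) (hc : ∀ v, 0 < c v)

/-- **IUTchII:Cor4.5(ii)** (kurims p.132) / **IUTchIII:Thm1.5(v)** (p.50) the kit-level bi-coric datum with the realified slot replaced
CANONICALLY by abc-iut-w4-d009's functor `D^⊢ ↦ (D^⊩(D^⊢), Prime ⥲ V̲, {ρ_{D^⊩,v}})` valued in the small model `RlfImage` (`ℝ_{>0}`-torsor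
Hom-sets), the Frobenius-like realified datum routed through `†ℋ𝒯 ↦ †𝔇^⊢_△`, and the Kummer datum := the FULL poly-isomorphism (= the
`ℝ_{>0}`-orbit of [IUTchII] Cor 4.6 (ii)). All other fields are those of `Bk`. [claim: Mochizuki2012, status: disputed] -/
def withRealifiedD : BiCoricKit X :=
  { Bk with
    RFrob := RlfImage line c hc
    catRFrob := inferInstance
    realified := realifiedDSmall line c hc
    realifiedHT := (HTRep.toDFunctor ⋙ Bk.dvDelta) ⋙ realifiedDSmall line c hc
    realifiedKummer := fun _ => PolyIso.full _ _
    realifiedKummer_nonempty := fun _ => ⟨Iso.refl _, PolyIso.mem_full _⟩ }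

/-- Unchanged: the log-shell category. [claim: Mochizuki2012, status: disputed] -/
@[simp] theorem withRealifiedD_Sh : (Bk.withRealifiedD line c hc).Sh = Bk.Sh := rfl

/-- Unchanged: `†ℋ𝒯^𝒟 ↦ †𝔇^⊢_△`. [claim: Mochizuki2012, status: disputed] -/
@[simp] theorem withRealifiedD_dvDelta : (Bk.withRealifiedD line c hc).dvDelta = Bk.dvDelta := rfl

/-- Unchanged: `𝔇^⊢ ↦ F^{⊢×μ}_△(𝔇^⊢)`. [claim: Mochizuki2012, status: disputed] -/
@[simp] theorem withRealifiedD_fxmOfDv : (Bk.withRealifiedD line c hc).fxmOfDv = Bk.fxmOfDv := rfl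

/-- Unchanged: `†ℋ𝒯 ↦ †𝔉^{⊢×μ}_△`. [claim: Mochizuki2012, status: disputed] -/
@[simp] theorem withRealifiedD_fxmDeltaHT : (Bk.withRealifiedD line c hc).fxmDeltaHT = Bk.fxmDeltaHT := rfl

/-- Unchanged: the Kummer isomorphisms of Thm 1.5 (iii). [claim: Mochizuki2012, status: disputed] -/
@[simp] theorem withRealifiedD_kummer : (Bk.withRealifiedD line c hc).kummer = Bk.kummer := rfl

/-- The replaced slot: `RFrob` is the small model `RlfImage line c hc`. [claim: Mochizuki2012, status: disputed] -/
theorem withRealifiedD_RFrob : (Bk.withRealifiedD line c hc).RFrob = RlfImage line c hc := rfl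

/-- The replaced slot: `realified` is Cor 4.5 (ii)'s functor `realifiedDSmall`. [claim: Mochizuki2012, status: disputed] -/
theorem withRealifiedD_realified : (Bk.withRealifiedD line c hc).realified = realifiedDSmall line c hc := rfl

/-- The LABELLED CHOICE: the Frobenius-like realified datum is routed through `†ℋ𝒯 ↦ †ℋ𝒯^𝒟 ↦ †𝔇^⊢_△`.
[claim: Mochizuki2012, status: disputed] -/
theorem withRealifiedD_realifiedHT :
    (Bk.withRealifiedD line c hc).realifiedHT = (HTRep.toDFunctor ⋙ Bk.dvDelta) ⋙ realifiedDSmall line c hc := rfl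

/-- **IUTchII:Cor4.6(ii)** (kurims p.133) the Kummer datum of the companion kit is the FULL poly-isomorphism (= the `ℝ_{>0}`-orbit, gen-2
`rlfImage_full_map_eq_orbit`). [claim: Mochizuki2012, status: disputed] -/
@[simp] theorem withRealifiedD_realifiedKummer (H : HTRep FK) :
    (Bk.withRealifiedD line c hc).realifiedKummer H = PolyIso.full _ _ := rfl

/-- **IUTchII:Cor4.10(v)** (kurims p.161 l.30–33) the companion's `RFrob` is the GENUINE torsor shape — not rigid: every object has a
non-identity automorphism (dilation by `2`). [claim: Mochizuki2012, status: disputed] -/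
theorem withRealifiedD_RFrob_exists_ne_id (A : (Bk.withRealifiedD line c hc).RFrob) : ∃ f : A ⟶ A, f ≠ 𝟙 A :=
  rlfImage_exists_ne_id line c hc A

/-- **IUTchIII:Thm1.5(v)** (kurims p.51) / **IUTchII:Cor4.6(ii)** — GAP G-w4d026-1's literal KIT-LEVEL law HOLDS for the companion kit:
transport along an isomorphism of (representative-level) Hodge theaters carries the `ℝ_{>0}`-orbit at `H` into the orbit at `H'`
(the orbits being full). [claim: Mochizuki2012, status: disputed] -/
theorem withRealifiedD_realifiedKummer_map {H H' : HTRep FK} (ξ : H ≅ H')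
    (e : (Bk.withRealifiedD line c hc).realifiedHT.obj H ≅
      (Bk.withRealifiedD line c hc).realified.obj ((Bk.withRealifiedD line c hc).dvDelta.obj (HTRep.toDFunctor.obj H)))
    (_he : e ∈ (Bk.withRealifiedD line c hc).realifiedKummer H) :
    ((Bk.withRealifiedD line c hc).realifiedHT.mapIso ξ).symm ≪≫ e ≪≫
        (Bk.withRealifiedD line c hc).realified.mapIso
          ((Bk.withRealifiedD line c hc).dvDelta.mapIso (HTRep.toDFunctor.mapIso ξ)) ∈
      (Bk.withRealifiedD line c hc).realifiedKummer H' :=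
  PolyIso.mem_full _

end BiCoricKit

/-! ### 2. The real frame: Thm 1.5 (v), rigidity, full orbits, the transport law -/

section Frame

variable (L) (hbij : FK.IsomFtoDBijective) (hsurj : FK.IsomFmtoDmSurjective) (hR : FK.RlfOfIsStrip)
  (X : TimesMuSide FK L) (Bk : BiCoricKit X)
  (line : M.DMono → K.V → RLine.{u}) (c : K.V → ℝ) (hc : ∀ v, 0 < c v)

/-- **IUTchIII:Thm1.5(v)** (kurims p.50) «induce [cf. [IUTchII], Corollaries 4.5, (ii); 4.10, (v)] AN isomorphism of collections of data»
HOLDS — `Thm15vSingleIso` (FACT-LIST F-2067's shape) — for the real frame's bi-coric data assembled from the companion kit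
`Bk.withRealifiedD line c hc`, with NO hypothesis: abc-iut-w4-d009's `thm15vSingleIso_ofKits_of_realifiedD` with the identity reading
(`Φ₀ := 𝟭`, `U₀ := inducedFunctor _`, `η₀ := realifiedDSmallForgetIso`). [claim: Mochizuki2012, status: disputed] -/
theorem thm15vSingleIso_ofKits_withRealifiedD :
    (BiCoricData.ofKits L hbij hsurj hR X (Bk.withRealifiedD line c hc)).Thm15vSingleIso :=
  @thm15vSingleIso_ofKits_of_realifiedD _ _ _ _ L hbij hsurj hR X (Bk.withRealifiedD line c hc) _ _ _ line c hc (𝟭 _)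
    (inducedFunctor (fun D : M.DMono => (realifiedD line c hc).obj D)) (InducedCategory.faithful _)
    (realifiedDSmallForgetIso line c hc ≪≫ (Functor.leftUnitor _).symm)

/-- **IUTchII:Cor4.10(v)** (kurims p.160) the consumer hypothesis `RealifiedRigidAt` (FACT-LIST F-2066's shape) HOLDS at every pair of
`𝒟^⊢`-prime-strips of the real frame, for the companion kit, with NO hypothesis. [claim: Mochizuki2012, status: disputed] -/
theorem realifiedRigidAt_ofKits_withRealifiedD (A B : (StripFrame.ofKits L hbij hsurj hR X).Dv) :
    (BiCoricData.ofKits L hbij hsurj hR X (Bk.withRealifiedD line c hc)).RealifiedRigidAt A B :=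
  @realifiedRigidAt_ofKits_of_realifiedD _ _ _ _ L hbij hsurj hR X (Bk.withRealifiedD line c hc) _ _ _ line c hc (𝟭 _)
    (inducedFunctor (fun D : M.DMono => (realifiedD line c hc).obj D)) (InducedCategory.faithful _)
    (realifiedDSmallForgetIso line c hc ≪≫ (Functor.leftUnitor _).symm) A B

/-- **IUTchII:Cor4.6(ii)** (kurims p.133) at the real frame every `ℝ_{>0}`-orbit datum of the companion is the FULL poly-isomorphism (the
small-model transport `liftPoly` of a full poly-isomorphism is full). [claim: Mochizuki2012, status: disputed] -/
theorem ofKits_withRealifiedD_realifiedKummer_eq_full (H : (StripFrame.ofKits L hbij hsurj hR X).HT) :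
    (BiCoricData.ofKits L hbij hsurj hR X (Bk.withRealifiedD line c hc)).realifiedKummer H = PolyIso.full _ _ := by
  ext e
  rw [BiCoricData.ofKits_mem_realifiedKummer_iff]
  exact ⟨fun _ => PolyIso.mem_full _, fun _ => PolyIso.mem_full _⟩

/-- **IUTchIII:Thm1.5(v)** (kurims p.51) GAP G-w4d026-1's literal FRAME-LEVEL law HOLDS for the companion: transport along an isomorphism of
Hodge theaters of the real frame carries the `ℝ_{>0}`-orbit into the `ℝ_{>0}`-orbit (abc-iut-L6-t3's `realifiedKummer_map_of_full`).
[claim: Mochizuki2012, status: disputed] -/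
theorem ofKits_withRealifiedD_realifiedKummer_map {A A' : (StripFrame.ofKits L hbij hsurj hR X).HT} (ξ : A ≅ A')
    (e : (BiCoricData.ofKits L hbij hsurj hR X (Bk.withRealifiedD line c hc)).realifiedHT.obj A ≅
      (BiCoricData.ofKits L hbij hsurj hR X (Bk.withRealifiedD line c hc)).realified.obj
        ((BiCoricData.ofKits L hbij hsurj hR X (Bk.withRealifiedD line c hc)).dvDelta.obj
          ((StripFrame.ofKits L hbij hsurj hR X).htToD.obj A)))
    (he : e ∈ (BiCoricData.ofKits L hbij hsurj hR X (Bk.withRealifiedD line c hc)).realifiedKummer A) :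
    ((BiCoricData.ofKits L hbij hsurj hR X (Bk.withRealifiedD line c hc)).realifiedHT.mapIso ξ).symm ≪≫ e ≪≫
        (BiCoricData.ofKits L hbij hsurj hR X (Bk.withRealifiedD line c hc)).realified.mapIso
          ((BiCoricData.ofKits L hbij hsurj hR X (Bk.withRealifiedD line c hc)).dvDelta.mapIso
            ((StripFrame.ofKits L hbij hsurj hR X).htToD.mapIso ξ)) ∈
      (BiCoricData.ofKits L hbij hsurj hR X (Bk.withRealifiedD line c hc)).realifiedKummer A' :=
  (BiCoricData.ofKits L hbij hsurj hR X (Bk.withRealifiedD line c hc)).realifiedKummer_map_of_full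
    (ofKits_withRealifiedD_realifiedKummer_eq_full L hbij hsurj hR X Bk line c hc) ξ e he

end Frame

end Literature.IUT.LogThetaLattice

end
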